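import Literature.MathematicalPhysics.QuantumLattice.GrassmannEffectiveActionTruncationDB
import Literature.MathematicalPhysics.QuantumLattice.GrassmannGaussConvKernelBound
import Literature.MathematicalPhysics.QuantumLattice.GrassmannKernelExpansion
import HarnessLib

/-!
# The linear part of the renormalisation-group map in BINOMIAL–GRAM form: Wick self-contractions cost `C(2m', r)·κ^{2m'-r}`,
# the identity part has coefficient exactly `1`

Topic `MathematicalPhysics/QuantumLattice`; companion of `GrassmannGaussConvKernelBound` (the linear part `e^{Δ_C}W` kernel by kernel,
each self-contraction costing the SUP norm of the covariance and the pattern count `(m+2j)!/(m! j! 2^j)` — factorial in the number `j` of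
contracted pairs, hence not uniform in the label set once `W` has kernels in every degree) and of `GrassmannFlowDB` /
`GrassmannFlowIterationSplit` (the same linear part in Gram form, `ρ^{-m} e ‖W‖_h` — no factorial, but the identity part of the map is
then charged `e·((κ+ρ)/ρ)^m ≥ e` instead of `1`, which forbids iterating the bound over many scales).  Here the two are combined:
for a charged covariance which is replica-Gram-bounded with constant `κ` (`IsGramBoundedR C κ`, de Siqueira Pedra–Salmhofer) and an
even `H` with pinned kernel norms `≤ N(m')` in degree `2m'`, in every degree `r`, one output label pinned,

  `Σ_{W : W_i = w} ‖kernel_r (e^{Δ_C} H) (W)‖ ≤ Σ_{m' : r ≤ 2m'} C(2m', r) · κ^{2m'-r} · N(m')`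

(**`sum_norm_kernel_gaussConv_le_binomial_of_gramBounded`**): the `2m' - r` contracted fields of a degree-`2m'` monomial are integrated
by the Gram–Hadamard bound (`κ^{2m'-r}`, no pairing count: the Pauli principle), and only the CHOICE of the contracted legs, `C(2m', r)`,
is counted.  This is the first cumulant (`n = 1`) of `GrassmannCumulantBoundDB.sum_norm_kernel_cumulantOf_le_of_gramBounded`, read
BEFORE the binomial/exponential majorisations of the all-order bound (there, for `n = 1`, the tree factor is `1 + λ α (2m')²` with `λ > 0`
free, and `λ → 0` is taken here).  Consequences:

* `cumulantBound_one` — the `n = 1` value of `cumulantBound`;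
* `kernel_presented_kernel` — the degree-`m` kernel of the degree-`m` presented part of `F` is the degree-`m` kernel of `F`;
* **`sum_norm_kernel_gaussConv_sub_le_binomial_of_gramBounded`** — `Σ_{W : W_i = w} ‖kernel_{2p} (e^{Δ_C} H - H) (W)‖ ≤
  Σ_{m' > p} C(2m', 2p) κ^{2m'-2p} N(m')` (the degree-`2p` part of `H` passes through `e^{Δ_C}` unchanged in degree `2p`);
* **`sum_norm_kernel_effAction_le_flow_binomial_of_gramBounded`** — one step of the flow of the kernels
  (`GrassmannFlowStep.sum_norm_kernel_effAction_le_flow`) with a label-set-uniform first-order term: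
  `Σ_{W : W_i = w} ‖kernel_{2p} (effAction C V) (W)‖ ≤ N(p) + Σ_{m' > p} C(2m', 2p) κ^{2m'-2p} N(m') + ρ^{-2p} e‖V‖_h θ/(1-θ)`,
  `θ = eα‖V‖_h/κ² < 1` (Benfatto–Giuliani–Mastropietro 2006, (2.61)–(2.63), (2.66): `𝒱' = 𝒱 + (tadpoles) + Σ_{n ≥ 2} 𝓔ᵀ/n!`).

With geometric majorants `N(m') ≤ A q^{m'}` the first-order sum is `≤ A q^{p} (1 - √(κ²q))^{-(2p+1)}`-type, uniform in `|Γ|` — the form a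
multi-scale iteration of single-scale bounds needs (cell gate-hubbard-kl, K3 engine child, clause (E1): E1-TOWER-AUDIT).

Everything is proved; no definition, no named fact.

## Sources

G. Benfatto, A. Giuliani, V. Mastropietro, Ann. Henri Poincaré 7 (2006) 809–898, (2.13)–(2.14), (2.77)–(2.80), (2.61)–(2.63), (2.66)
[`BenfattoGiulianiMastropietro2006`]; K. Gawȩdzki, A. Kupiainen, Comm. Math. Phys. 102 (1985) 1–30, §3 [`GawedzkiKupiainen1985GrossNeveu`];
W. de Siqueira Pedra, M. Salmhofer, Comm. Math. Phys. 282 (2008) 797–818, Thm 1.3 [`PedraSalmhofer2008`]; M. Salmhofer, *Renormalization*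
(1999), §4.3 (4.86)–(4.95) [`Salmhofer1999`].
-/

noncomputable section

namespace Literature.MathematicalPhysics.QuantumLattice

open GrassmannAlgebra Finset Literature.Probability.LatticeModels
open scoped Nat

universe u

variable {𝕜 : Type*} [RCLike 𝕜] {Γ : Type u} [Fintype Γ] [DecidableEq Γ] (C : Matrix Γ Γ 𝕜)

/-! ### The first cumulant of `cumulantBound` -/

/-- **The `n = 1` value of `cumulantBound`**: one vertex of degree `2m'`, `r` output legs, no tree line; the tree factor is
`1 + λ α (2m')²` (the single diagonal "pair" of `Sym2 (Fin 1)`), and `(r!)⁻¹ (2m')^{(r)} = C(2m', r)`.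
[cite: BenfattoGiulianiMastropietro2006, (2.77)-(2.80)] -/
theorem cumulantBound_one (κ α lam : ℝ) (N : ℕ → ℝ) (r m' : ℕ) :
    cumulantBound 1 κ α lam N r (fun _ : Fin 1 => m') =
      ((2 * m').choose r : ℝ) * κ ^ (2 * m' - r) * N m' * (1 + lam * (α * ((2 * m') * (2 * m') : ℕ))) := by
  have hsub : Subsingleton (Sym2 (Fin 1)) := ⟨by
    intro x y
    induction x using Sym2.ind with
    | _ a b =>
      induction y using Sym2.ind with
      | _ c d => rw [Subsingleton.elim a c, Subsingleton.elim b d]⟩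
  have hprod : ∏ ℓ : Sym2 (Fin 1), (1 + lam * (α * (pairDeg (fun _ : Fin 1 => 2 * m') ℓ : ℝ))) =
      1 + lam * (α * ((2 * m') * (2 * m') : ℕ)) := by
    haveI := hsub
    set ℓ₀ : Sym2 (Fin 1) := Sym2.mk (0 : Fin 1) (0 : Fin 1) with hℓ₀
    have huniv : (univ : Finset (Sym2 (Fin 1))) = ({ℓ₀} : Finset (Sym2 (Fin 1))) :=
      eq_singleton_iff_unique_mem.2 ⟨mem_univ ℓ₀, fun x _ => Subsingleton.elim x ℓ₀⟩
    rw [huniv, prod_singleton, hℓ₀]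
    simp only [pairDeg, Sym2.lift_mk]
  unfold cumulantBound
  simp only [Fin.sum_univ_one, Fin.prod_univ_one, Nat.sub_self, mul_zero, add_zero, pow_zero, one_mul]
  rw [hprod, Nat.descFactorial_eq_factorial_mul_choose, Nat.cast_mul]
  have hr : (r ! : ℝ) ≠ 0 := by positivity
  rw [inv_mul_cancel_left₀ hr]

omit [Fintype Γ] [DecidableEq Γ] in
/-- The kernels are additive: `kernel (F - G) = kernel F - kernel G`. [folklore] -/
private theorem kernel_sub_aux (F G : GrassmannAlgebra 𝕜 Γ) (m : ℕ) (X : Fin m → Γ) :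
    kernel 𝕜 (F - G) m X = kernel 𝕜 F m X - kernel 𝕜 G m X := by
  rw [sub_eq_add_neg, kernel_add, show -G = (-1 : 𝕜) • G from (neg_one_smul 𝕜 G).symm, kernel_smul]
  ring

/-! ### The linear part in binomial–Gram form -/

/-- **The Gaussian convolution in binomial–Gram form** (first cumulant of BGM 2006 (2.77)–(2.80), read before the exponential
majorisations): `C` replica-Gram-bounded with constant `κ ≥ 0`, `H` even with pinned kernel norms `≤ N(m')` in degree `2m'`; then in every
degree `r`, one output label pinned, `Σ_{W : W_i = w} ‖kernel_r (e^{Δ_C} H) (W)‖ ≤ Σ_{m' ≤ |Γ|/2, r ≤ 2m'} C(2m', r) κ^{2m'-r} N(m')`.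
No row/column-sum hypothesis is needed (no tree line at first order). [cite: BenfattoGiulianiMastropietro2006, (2.77)-(2.80)] -/
theorem sum_norm_kernel_gaussConv_le_binomial_of_gramBounded {κ : ℝ} (hκ : 0 ≤ κ) (hGB : IsGramBoundedR C κ)
    (H : GrassmannAlgebra 𝕜 Γ) (hH : H ∈ evenPart 𝕜 Γ) (N : ℕ → ℝ) (hN0 : ∀ m', 0 ≤ N m')
    (hN : ∀ m' (j : Fin (2 * m')) (w : Γ), ∑ Y ∈ univ.filter (fun Y : Fin (2 * m') → Γ => Y j = w), ‖kernel 𝕜 H (2 * m') Y‖ ≤ N m')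
    {r : ℕ} (i : Fin r) (w : Γ) :
    ∑ W ∈ univ.filter (fun W : Fin r → Γ => W i = w), ‖kernel 𝕜 (gaussConv 𝕜 C H) r W‖ ≤
      ∑ m' ∈ range (Fintype.card Γ / 2 + 1), if r ≤ 2 * m' then ((2 * m').choose r : ℝ) * κ ^ (2 * m' - r) * N m' else 0 := by
  -- `H` presented by its even kernels
  set X : evenPart 𝕜 Γ := ⟨H, hH⟩ with hX
  set degs : Finset ℕ := range (Fintype.card Γ / 2 + 1) with hdegs
  set K : (m' : ℕ) → (Fin (2 * m') → Γ) → 𝕜 := fun m' => kernel 𝕜 H (2 * m') with hK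
  have hXv : vertexOf 𝕜 degs K = X := Subtype.ext (coe_vertexOf_kernel_eq 𝕜 X)
  -- a (crude) bound on the row and column sums of `‖C‖`: they only enter the tree factor, which is sent to `1`
  set α₀ : ℝ := ∑ A, ∑ B, ‖C A B‖ with hα₀
  have hα₀0 : 0 ≤ α₀ := sum_nonneg fun A _ => sum_nonneg fun B _ => norm_nonneg _
  have hrow : ∀ A, ∑ B, ‖C A B‖ ≤ α₀ := fun A =>
    single_le_sum (f := fun A => ∑ B, ‖C A B‖) (fun A _ => sum_nonneg fun B _ => norm_nonneg _) (mem_univ A)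
  have hcol : ∀ B, ∑ A, ‖C A B‖ ≤ α₀ := fun B => by
    rw [hα₀, sum_comm]
    exact single_le_sum (f := fun B => ∑ A, ‖C A B‖) (fun B _ => sum_nonneg fun A _ => norm_nonneg _) (mem_univ B)
  -- the terms of the claimed bound, and of its `λ`-perturbation
  set T : ℕ → ℝ := fun m' => if r ≤ 2 * m' then ((2 * m').choose r : ℝ) * κ ^ (2 * m' - r) * N m' else 0 with hT
  set D : ℕ → ℝ := fun m' => α₀ * ((2 * m') * (2 * m') : ℕ) with hD
  have hT0 : ∀ m', 0 ≤ T m' := fun m' => by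
    simp only [hT]
    split_ifs
    · exact mul_nonneg (mul_nonneg (Nat.cast_nonneg _) (pow_nonneg hκ _)) (hN0 m')
    · exact le_rfl
  have hD0 : ∀ m', 0 ≤ D m' := fun m' => mul_nonneg hα₀0 (Nat.cast_nonneg _)
  -- the first cumulant bound, for every `λ = t > 0`
  have key : ∀ t : ℝ, 0 < t →
      ∑ W ∈ univ.filter (fun W : Fin r → Γ => W i = w), ‖kernel 𝕜 (gaussConv 𝕜 C H) r W‖ ≤
        ∑ m' ∈ degs, T m' + t * ∑ m' ∈ degs, T m' * D m' := by
    intro t ht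
    have h := sum_norm_kernel_cumulantOf_le_of_gramBounded C hκ hGB degs K N hN0 (fun m' j w' => hN m' j w') hα₀0 hrow hcol
      (fun _ => t) (fun _ => ht) one_pos i w
    have hcum : ((cumulantOf (fun k => evenGaussConv 𝕜 C (vertexOf 𝕜 degs K ^ k)) 1 : evenPart 𝕜 Γ) : GrassmannAlgebra 𝕜 Γ) =
        gaussConv 𝕜 C H := by
      rw [cumulantOf_one, pow_one, hXv, coe_evenGaussConv]
    rw [hcum, Nat.cast_one, one_mul] at h
    refine h.trans ?_
    -- each degree assignment `δ : Fin 1 → ℕ` is `fun _ => δ 0`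
    have hterm : ∀ δ ∈ Fintype.piFinset (fun _ : Fin 1 => degs),
        (if r + 2 * (1 - 1) ≤ ∑ a, 2 * δ a then cumulantBound 1 κ α₀ t N r δ else 0) = T (δ 0) * (1 + t * D (δ 0)) := by
      intro δ _
      obtain ⟨m', hm'⟩ : ∃ m', δ = fun _ => m' := ⟨δ 0, funext fun a => congrArg δ (Subsingleton.elim a 0)⟩
      subst hm'
      simp only [Fin.sum_univ_one, Nat.sub_self, mul_zero, add_zero, hT, hD]
      split_ifs with hle
      · rw [cumulantBound_one]
      · rw [zero_mul]
    rw [sum_congr rfl hterm]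
    -- reindex by `m' = δ 0`
    have hre : ∑ δ ∈ Fintype.piFinset (fun _ : Fin 1 => degs), T (δ 0) * (1 + t * D (δ 0)) =
        ∑ m' ∈ degs, T m' * (1 + t * D m') := by
      refine sum_nbij' (fun δ => δ 0) (fun m' _ => m') ?_ ?_ ?_ ?_ ?_
      · intro δ hδ
        exact (Fintype.mem_piFinset.1 (mem_coe.1 hδ)) 0
      · intro m' hm'
        exact Fintype.mem_piFinset.2 fun _ => mem_coe.1 hm'
      · intro δ _
        exact funext fun a => congrArg δ (Subsingleton.elim 0 a)
      · intro m' _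
        rfl
      · intro δ _
        rfl
    rw [hre]
    refine le_of_eq ?_
    rw [mul_sum, ← sum_add_distrib]
    exact sum_congr rfl fun m' _ => by ring
  -- `λ → 0`
  refine le_of_forall_pos_le_add fun ε hε => ?_
  set B₁ : ℝ := ∑ m' ∈ degs, T m' * D m' with hB₁
  have hB₁0 : 0 ≤ B₁ := sum_nonneg fun m' _ => mul_nonneg (hT0 m') (hD0 m')
  have ht : 0 < ε / (B₁ + 1) := div_pos hε (by linarith)
  have hkey := key _ ht
  have hmul : ε / (B₁ + 1) * B₁ ≤ ε := by
    rw [div_mul_eq_mul_div, div_le_iff₀ (by linarith)]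
    nlinarith
  linarith

/-! ### The presented part of one degree -/

omit [Fintype Γ] in
/-- **The degree-`m` kernel of the degree-`m` presented part of `F` is the degree-`m` kernel of `F`** (the kernels are already
antisymmetric). [cite: Salmhofer1999, §4.3 (4.95)] -/
theorem kernel_presented_kernel [Fintype Γ] (F : GrassmannAlgebra 𝕜 Γ) (m : ℕ) (X : Fin m → Γ) :
    kernel 𝕜 (presented 𝕜 (kernel 𝕜 F m)) m X = kernel 𝕜 F m X := by
  have hF := eq_sum_presented_kernel 𝕜 F
  by_cases hm : m ∈ range (Fintype.card Γ + 1)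
  · conv_rhs => rw [hF, kernel_sum]
    rw [sum_eq_single_of_mem m hm fun m'' _ hne => kernel_presented_of_ne 𝕜 _ X (Ne.symm hne)]
  · -- above the top degree every kernel vanishes
    have hzero : ∀ Y : Fin m → Γ, kernel 𝕜 F m Y = 0 := by
      intro Y
      conv_lhs => rw [hF, kernel_sum]
      exact sum_eq_zero fun m'' hm'' => kernel_presented_of_ne 𝕜 _ Y (by rintro rfl; exact hm hm'')
    rw [hzero X, show kernel 𝕜 F m = 0 from funext hzero, presented_zero, kernel_zero_right]

/-! ### The linear part minus the identity -/

/-- **`e^{Δ_C} H - H` in binomial–Gram form**: in an even degree `2p` only the HIGHER kernels of `H` contribute, by self-contraction: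
`Σ_{W : W_i = w} ‖kernel_{2p} (e^{Δ_C} H - H) (W)‖ ≤ Σ_{p < m' ≤ |Γ|/2} C(2m', 2p) κ^{2m'-2p} N(m')` — for a quartic `H` nothing in degree
`4` and the tadpole `C(4,2) κ² N(2) = 6κ²N(2)` in degree `2`. [cite: BenfattoGiulianiMastropietro2006, (2.61)-(2.63), (2.66)] -/
theorem sum_norm_kernel_gaussConv_sub_le_binomial_of_gramBounded {κ : ℝ} (hκ : 0 ≤ κ) (hGB : IsGramBoundedR C κ)
    (H : GrassmannAlgebra 𝕜 Γ) (hH : H ∈ evenPart 𝕜 Γ) (N : ℕ → ℝ) (hN0 : ∀ m', 0 ≤ N m')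
    (hN : ∀ m' (j : Fin (2 * m')) (w : Γ), ∑ Y ∈ univ.filter (fun Y : Fin (2 * m') → Γ => Y j = w), ‖kernel 𝕜 H (2 * m') Y‖ ≤ N m')
    {p : ℕ} (i : Fin (2 * p)) (w : Γ) :
    ∑ W ∈ univ.filter (fun W : Fin (2 * p) → Γ => W i = w), ‖kernel 𝕜 (gaussConv 𝕜 C H - H) (2 * p) W‖ ≤
      ∑ m' ∈ range (Fintype.card Γ / 2 + 1), if p < m' then ((2 * m').choose (2 * p) : ℝ) * κ ^ (2 * m' - 2 * p) * N m' else 0 := by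
  -- the degree-`2p` part of `H` and the rest
  set Hp : GrassmannAlgebra 𝕜 Γ := presented 𝕜 (kernel 𝕜 H (2 * p)) with hHp
  have hHp_even : Hp ∈ evenPart 𝕜 Γ := by
    have hcoe : Hp = ((∑ Y : Fin (2 * p) → Γ, kernel 𝕜 H (2 * p) Y • evenGenProd (even_two_mul p) Y : evenPart 𝕜 Γ) :
        GrassmannAlgebra 𝕜 Γ) := by
      rw [hHp, AddSubmonoidClass.coe_finsetSum, presented]
      exact sum_congr rfl fun Y _ => by rw [Subalgebra.coe_smul, coe_evenGenProd]
    rw [hcoe]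
    exact Subtype.mem _
  set H' : GrassmannAlgebra 𝕜 Γ := H - Hp with hH'
  have hH'even : H' ∈ evenPart 𝕜 Γ := sub_mem hH hHp_even
  -- kernels of `Hp` and `H'`
  have hkerHp_top : ∀ Y : Fin (2 * p) → Γ, kernel 𝕜 Hp (2 * p) Y = kernel 𝕜 H (2 * p) Y := fun Y => by
    rw [hHp, kernel_presented_kernel]
  have hkerHp_ne : ∀ {n : ℕ}, n ≠ 2 * p → ∀ Y : Fin n → Γ, kernel 𝕜 Hp n Y = 0 := fun hn Y => by
    rw [hHp, kernel_presented_of_ne 𝕜 _ Y hn]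
  have hkerH'_top : ∀ Y : Fin (2 * p) → Γ, kernel 𝕜 H' (2 * p) Y = 0 := fun Y => by
    rw [hH', kernel_sub_aux, hkerHp_top, sub_self]
  have hkerH'_ne : ∀ {m' : ℕ}, m' ≠ p → ∀ Y : Fin (2 * m') → Γ, kernel 𝕜 H' (2 * m') Y = kernel 𝕜 H (2 * m') Y :=
    fun {m'} hm' Y => by
    rw [hH', kernel_sub_aux, hkerHp_ne (by omega), sub_zero]
  -- (1) the degree-`2p` kernel of `e^{Δ_C} Hp - Hp` vanishes (nothing higher to contract)
  obtain ⟨k, hk⟩ := isNilpotent_grassmannLaplacian 𝕜 C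
  set s : ℝ := ∑ A, ∑ B, ‖C A B‖ with hs
  have hsC : ∀ A B, ‖C A B‖ ≤ s := fun A B =>
    (single_le_sum (f := fun B => ‖C A B‖) (fun B _ => norm_nonneg _) (mem_univ B)).trans
      (single_le_sum (f := fun A => ∑ B, ‖C A B‖) (fun A _ => sum_nonneg fun B _ => norm_nonneg _) (mem_univ A))
  set NP : ℕ → ℝ := fun n => if n = 2 * p then N p else 0 with hNPdef
  have hNP : ∀ (n : ℕ) (q : Fin n) (w' : Γ), ∑ Z ∈ univ.filter (fun Z : Fin n → Γ => Z q = w'),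
      ‖kernel 𝕜 Hp n Z‖ ≤ NP n := by
    intro n q w'
    by_cases hn : n = 2 * p
    · subst hn
      simp only [hNPdef, if_true, hkerHp_top]
      exact hN p q w'
    · simp only [hNPdef, if_neg hn, hkerHp_ne hn, norm_zero, sum_const_zero, le_refl]
  have hvan : ∀ W : Fin (2 * p) → Γ, kernel 𝕜 (gaussConv 𝕜 C Hp - Hp) (2 * p) W = 0 := by
    intro W
    have h := sum_norm_kernel_gaussConv_sub_le C hk hsC Hp NP hNP (2 * p) i (W i)
    have hzero : ∑ j ∈ Ico 1 k, ((2 * p + 2 * j)! : ℝ) / (((2 * p) ! : ℝ) * (j ! : ℝ) * 2 ^ j) * s ^ j * NP (2 * p + 2 * j) = 0 :=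
      sum_eq_zero fun j hj => by
        have hj1 : 1 ≤ j := (mem_Ico.1 hj).1
        rw [hNPdef]
        dsimp only
        rw [if_neg (by omega), mul_zero]
    rw [hzero] at h
    have hmem : W ∈ univ.filter (fun Z : Fin (2 * p) → Γ => Z i = W i) := mem_filter.2 ⟨mem_univ _, rfl⟩
    have h' := (sum_eq_zero_iff_of_nonneg fun Z _ => norm_nonneg _).1
      (le_antisymm h (sum_nonneg fun Z _ => norm_nonneg _)) W hmem
    exact norm_eq_zero.1 h'
  -- (2) hence the degree-`2p` kernel of `e^{Δ_C} H - H` is that of `e^{Δ_C} H'`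
  have hsplit : ∀ W : Fin (2 * p) → Γ, kernel 𝕜 (gaussConv 𝕜 C H - H) (2 * p) W = kernel 𝕜 (gaussConv 𝕜 C H') (2 * p) W := by
    intro W
    have hdec : gaussConv 𝕜 C H - H = gaussConv 𝕜 C H' + (gaussConv 𝕜 C Hp - Hp) - H' := by
      rw [hH', map_sub]
      abel
    rw [hdec, kernel_sub_aux, kernel_add, hvan W, hkerH'_top W, add_zero, sub_zero]
  -- (3) the binomial–Gram bound for `H'`, whose degree-`2p` kernel vanishes
  set N' : ℕ → ℝ := fun m' => if m' = p then 0 else N m' with hN'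
  have hN'0 : ∀ m', 0 ≤ N' m' := fun m' => by simp only [hN']; split_ifs; exacts [le_rfl, hN0 m']
  have hN'H : ∀ m' (j : Fin (2 * m')) (w' : Γ), ∑ Y ∈ univ.filter (fun Y : Fin (2 * m') → Γ => Y j = w'), ‖kernel 𝕜 H' (2 * m') Y‖ ≤ N' m' := by
    intro m' j w'
    by_cases hm' : m' = p
    · subst hm'
      simp only [hN', if_true, hkerH'_top, norm_zero, sum_const_zero, le_refl]
    · simp only [hN', if_neg hm', hkerH'_ne hm']
      exact hN m' j w'
  have h := sum_norm_kernel_gaussConv_le_binomial_of_gramBounded C hκ hGB H' hH'even N' hN'0 hN'H i w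
  rw [sum_congr rfl fun W _ => by rw [hsplit W]]
  refine h.trans (sum_le_sum fun m' _ => ?_)
  simp only [hN']
  by_cases hm' : m' = p
  · subst hm'
    simp
  · by_cases hlt : p < m'
    · rw [if_pos (by omega), if_neg hm', if_pos hlt]
    · have hgt : ¬ 2 * p ≤ 2 * m' := by omega
      rw [if_neg hgt, if_neg hlt]

/-! ### One step of the flow of the kernels, binomial–Gram form -/

/-- **One step of the flow of the kernels with a label-set-uniform first-order term** (BGM 2006 (2.61)–(2.63), (2.66), Gawȩdzki–Kupiainen 1985 §3;
the binomial–Gram twin of `GrassmannFlowStep.sum_norm_kernel_effAction_le_flow`): `C` replica-Gram-bounded (`κ > 0`) with row and column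
sums `≤ α`, `V` even without constant term with pinned kernel norms `≤ N(m')` in degree `2m'`, `θ = eα‖V‖_h/κ² < 1`; then in every even
degree `2p ≥ 2`, one output label pinned,
`Σ_{W : W_i = w} ‖kernel_{2p} (effAction C V) (W)‖ ≤ N(p) + Σ_{p < m' ≤ |Γ|/2} C(2m', 2p) κ^{2m'-2p} N(m') + ρ^{-2p} e‖V‖_h θ/(1-θ)`:
identity, Wick self-contractions of the higher kernels, and the orders `≥ 2`. [cite: BenfattoGiulianiMastropietro2006, (2.61)-(2.63), (2.66)] -/
theorem sum_norm_kernel_effAction_le_flow_binomial_of_gramBounded {κ : ℝ} (hκ : 0 < κ) (hGB : IsGramBoundedR C κ)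
    (V : GrassmannAlgebra 𝕜 Γ) (hV : V ∈ evenPart 𝕜 Γ) (hV0 : constPart 𝕜 V = 0) (N : ℕ → ℝ) (hN0 : ∀ m', 0 ≤ N m')
    (hN : ∀ m' (j : Fin (2 * m')) (w : Γ), ∑ Y ∈ univ.filter (fun Y : Fin (2 * m') → Γ => Y j = w), ‖kernel 𝕜 V (2 * m') Y‖ ≤ N m')
    {α : ℝ} (hα : 0 < α) (hrow : ∀ X, ∑ Y, ‖C X Y‖ ≤ α) (hcol : ∀ Y, ∑ X, ‖C X Y‖ ≤ α) {ρ : ℝ} (hρ : 0 < ρ)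
    (hθ : Real.exp 1 * α * normV Γ κ ρ N / κ ^ 2 < 1) {p : ℕ} (i : Fin (2 * p)) (w : Γ) :
    ∑ W ∈ univ.filter (fun W : Fin (2 * p) → Γ => W i = w), ‖kernel 𝕜 (effAction 𝕜 C V) (2 * p) W‖ ≤
      N p + (∑ m' ∈ range (Fintype.card Γ / 2 + 1), if p < m' then ((2 * m').choose (2 * p) : ℝ) * κ ^ (2 * m' - 2 * p) * N m' else 0) +
        ρ⁻¹ ^ (2 * p) * (Real.exp 1 * normV Γ κ ρ N) *
          (Real.exp 1 * α * normV Γ κ ρ N / κ ^ 2) / (1 - Real.exp 1 * α * normV Γ κ ρ N / κ ^ 2) := by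
  have hp : 0 < 2 * p := Fin.pos i
  -- the three pieces
  have h1 := hN p i w
  have h2 := sum_norm_kernel_gaussConv_sub_le_binomial_of_gramBounded C hκ.le hGB V hV N hN0 hN i w
  obtain ⟨-, h3⟩ := sum_norm_kernel_effAction_sub_gaussConv_le_of_gramBounded C hκ hGB V hV hV0 N hN0 hN hα hrow hcol hρ hθ
  have h3' := h3 hp i w
  -- `𝒱' = V + (e^{Δ}V - V) + (𝒱' - e^{Δ}V)`
  have hsplit : ∀ W, kernel 𝕜 (effAction 𝕜 C V) (2 * p) W = kernel 𝕜 V (2 * p) W + kernel 𝕜 (gaussConv 𝕜 C V - V) (2 * p) W +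
      kernel 𝕜 (effAction 𝕜 C V - gaussConv 𝕜 C V) (2 * p) W := by
    intro W
    rw [← kernel_add, ← kernel_add]
    congr 1
    abel
  calc ∑ W ∈ univ.filter (fun W : Fin (2 * p) → Γ => W i = w), ‖kernel 𝕜 (effAction 𝕜 C V) (2 * p) W‖
      ≤ ∑ W ∈ univ.filter (fun W : Fin (2 * p) → Γ => W i = w), (‖kernel 𝕜 V (2 * p) W‖ + ‖kernel 𝕜 (gaussConv 𝕜 C V - V) (2 * p) W‖ +
          ‖kernel 𝕜 (effAction 𝕜 C V - gaussConv 𝕜 C V) (2 * p) W‖) :=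
        sum_le_sum fun W _ => by rw [hsplit W]; exact norm_add₃_le
    _ = _ := by rw [sum_add_distrib, sum_add_distrib]
    _ ≤ _ := add_le_add (add_le_add h1 h2) h3'

end Literature.MathematicalPhysics.QuantumLattice

end
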